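import Summits.BirchSwinnertonDyer.BirchSwinnertonDyer.Theorems.KimAtThreeFineKatoKPortCuspChart
import HarnessLib

/-!
# F″ programme, piece P2a: CUSP DATA of an additively reducing model at `p ≥ 5` — the reduced cubic IS a
# singular model `singularModel x̄₀ ȳ₀ ᾱ ᾱ` with `x₀, y₀, α ∈ ℤ_p` (the `p ∤ 6` twin of `…KPortCuspThree`)
# (`--supports stmt-BirchSwinnertonDyer-22226`, helper; route EdixhovenFibreFiveSeven)

HONEST FRAMING. Route `EdixhovenFibreFiveSeven`, crux K★ `StarredOptimalManinUnitFiveSeven`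
(stmt-BirchSwinnertonDyer-22226), line `kato-lever`: K★ ⟸ F″ (p581141); the F″ programme map
(`Cruxes/StarredOptimalManinUnitFiveSeven/Lines/kato-lever-F2-programme.md` §4) asks, as piece **P2**, for the
RECEPTACLE over an UNRAMIFIED complete `K ⊇ ℚ_p`: `log_ω(E(K)) = 𝒪_K` for the minimal model at an additive `p ≥ 5`
(off the Kosters–Pannekoek exception). Its index count `Λ̃(E₀(K)) = 𝒪_K` runs through the W2 K-port's
`k`-RATIONAL CUSP CHART `r : E₀(K) ↠ k⁺` (`…Theorems.KimAtThreeFineKatoKPortCuspChart`: kernel `E₁(K)`, ONTO by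
Hensel), which is stated GIVEN cusp data `hV : Ṽ = singularModel x̄₀ ȳ₀ ᾱ ᾱ` with `x₀, y₀, α ∈ ℤ_p` — discharged in
the tree only at `p = 3` (`…KPortCuspThree.map_residue_eq_singularModel_of_three`). THIS FILE discharges it for
every `p ≥ 5` (indeed whenever `6` is a unit): for a Weierstrass cubic over a field with `2, 3 ≠ 0` and
`Δ = c₄ = 0` (then `c₆ = 0` by `1728Δ = c₄³ − c₆²`) the cusp is RATIONAL, at `x₀ = −b₂/12`,
`y₀ = −(a₁x₀ + a₃)/2`, with double tangent slope `α = −a₁/2` (Silverman III.1.4: `x₀` is the triple root of the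
`2`-division cubic `4x³ + b₂x² + 2b₄x + b₆`). TOOL theorems only (no definition, no named fact, no `sorry`);
closes nothing by itself; BSD is not proved by any of this.

## Contents

* §1 (any field `k` with `(2 : k) ≠ 0`, `(3 : k) ≠ 0`) `c₆_eq_zero_of_Δ_eq_zero_of_c₄_eq_zero`;
  ★ `eq_singularModel_of_cusp` — `Δ = 0`, `c₄ = 0`, `12x₀ = −b₂`, `2y₀ = −(a₁x₀ + a₃)`, `2α = −a₁` ⟹
  `V = singularModel x₀ y₀ α α` (division-free hypotheses, so that it transports along ring maps).
* §2 (K-port currency: `M/ℤ_p`, `K ⊇ ℚ_p` ultrametric normed, `k = 𝒪_K/𝔪_K`, `p ≥ 5`)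
  ★ `exists_map_residue_eq_singularModel_of_five_le` — `‖Δ(M)‖ < 1`, `‖c₄(M)‖ < 1` ⟹
  `∃ x₀ y₀ α : ℤ_p, Ṽ = singularModel x̄₀ ȳ₀ ᾱ ᾱ`, the hypothesis `hV` of the K-port's cusp chart; hence
  `exists_cuspData_of_addv` for `M = W_ℤ ⊗ ℤ_p` at an additive prime `p ≥ 5` of a globally minimal `W/ℚ`.

References: J. H. Silverman, *The Arithmetic of Elliptic Curves*, 2nd ed. (2009), III.1 Prop. 1.4(a),
III.2 Prop. 2.5, VII.5 Prop. 5.1 [SilvermanAEC2009]; programme map `…/kato-lever-F2-programme.md` §4 (P2).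
-/

noncomputable section

-- the cell's Theorems namespace `Summit.BirchSwinnertonDyer.BirchSwinnertonDyer.…` repeats the summit name by design (D-0017)
set_option linter.dupNamespace false

open scoped Classical

namespace Summit.BirchSwinnertonDyer.BirchSwinnertonDyer.Theorems.StarredOptimalManinUnitFiveSevenReceptacle

open Summit.BirchSwinnertonDyer.Rank1Residual.Additive.BallEval
open Summit.BirchSwinnertonDyer.BirchSwinnertonDyer.Theorems.KPort
open Literature.NumberTheory.GaloisRepresentations.LubinTate (unitBall mem_unitBall_iff)
open Literature.NumberTheory.EllipticCurves.Rank1Residual WeierstrassCurve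

/-! ## §1 The rational cusp of a Weierstrass cubic with `Δ = c₄ = 0` in characteristic `∤ 6` -/

section Field

variable {k : Type*} [Field k] (V : WeierstrassCurve k)

/-- `Δ = 0` and `c₄ = 0` force `c₆ = 0` (`1728Δ = c₄³ − c₆²`). [cite: SilvermanAEC2009, III.1 Prop. 1.4(a)] -/
theorem c₆_eq_zero_of_Δ_eq_zero_of_c₄_eq_zero (hΔ : V.Δ = 0) (hc₄ : V.c₄ = 0) : V.c₆ = 0 := by
  have h := V.c_relation
  rw [hΔ, hc₄, mul_zero, zero_pow three_ne_zero, zero_sub] at h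
  exact (pow_eq_zero_iff two_ne_zero).mp (neg_eq_zero.mp h.symm)

/-- **The rational cusp (characteristic `∤ 6`).** If `2, 3 ≠ 0` in `k`, `Δ(V) = 0` and `c₄(V) = 0`, then with
`12x₀ = −b₂`, `2y₀ = −(a₁x₀ + a₃)`, `2α = −a₁` the cubic `V` IS `singularModel x₀ y₀ α α`: a CUSP at the
`k`-rational point `(x₀, y₀)` with double tangent slope `α` (`x₀` is the triple root of the `2`-division cubic;
the tree's `eq_singularModel` with `f_x = f_y = 0` at `(x₀, y₀)` and `α + α = −a₁`, `α² = −(a₂ + 3x₀)`).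
[cite: SilvermanAEC2009, III.1 Prop. 1.4(a) and III.2 Prop. 2.5(b)] -/
theorem eq_singularModel_of_cusp (h2 : (2 : k) ≠ 0) (h3 : (3 : k) ≠ 0) (hΔ : V.Δ = 0) (hc₄ : V.c₄ = 0)
    {x₀ y₀ α : k} (hx : 12 * x₀ = -V.b₂) (hy : 2 * y₀ = -(V.a₁ * x₀ + V.a₃)) (hα : 2 * α = -V.a₁) :
    V = singularModel x₀ y₀ α α := by
  have hc₆ := c₆_eq_zero_of_Δ_eq_zero_of_c₄_eq_zero V hΔ hc₄
  have h4 : (4 : k) ≠ 0 := by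
    rw [show (4 : k) = 2 * 2 by norm_num]; exact mul_ne_zero h2 h2
  have h12 : (12 : k) ≠ 0 := by
    rw [show (12 : k) = 4 * 3 by norm_num]; exact mul_ne_zero h4 h3
  have h48 : (48 : k) ≠ 0 := by
    rw [show (48 : k) = 4 * 12 by norm_num]; exact mul_ne_zero h4 h12
  -- the `b`- and `c`-relations, unfolded once
  have eb₂ : V.b₂ = V.a₁ ^ 2 + 4 * V.a₂ := rfl
  have eb₄ : V.b₄ = 2 * V.a₄ + V.a₁ * V.a₃ := rfl
  have eb₆ : V.b₆ = V.a₃ ^ 2 + 4 * V.a₆ := rfl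
  have ec₄ : V.b₂ ^ 2 - 24 * V.b₄ = 0 := by rw [← hc₄]; rfl
  have ec₆ : -V.b₂ ^ 3 + 36 * V.b₂ * V.b₄ - 216 * V.b₆ = 0 := by rw [← hc₆]; rfl
  -- `f_y = 0`
  have hY : 2 * y₀ + V.a₁ * x₀ + V.a₃ = 0 := by linear_combination hy
  -- tangent slopes
  have hs : α + α = -V.a₁ := by linear_combination hα
  have hp : α * α = -(V.a₂ + 3 * x₀) := by
    refine mul_left_cancel₀ h4 ?_
    linear_combination (2 * α - V.a₁) * hα + hx - eb₂
  -- `f_x = 0`: `48·(a₁y₀ − 3x₀² − 2a₂x₀ − a₄) = c₄ − (b₂ + 12x₀)(12x₀ + b₂) + …`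
  have hX : V.a₁ * y₀ = 3 * x₀ ^ 2 + 2 * V.a₂ * x₀ + V.a₄ := by
    refine mul_left_cancel₀ h48 ?_
    linear_combination 24 * V.a₁ * hy - (V.b₂ + 12 * x₀) * hx + ec₄ + 24 * x₀ * eb₂ + 24 * eb₄
  -- `f = 0`: `x₀` is a root of the `2`-division cubic (`c₆ = 0`), and `(2y₀ + a₁x₀ + a₃)² = 4x³ + b₂x² + 2b₄x + b₆`
  have hF : 4 * x₀ ^ 3 + V.b₂ * x₀ ^ 2 + 2 * V.b₄ * x₀ + V.b₆ = 0 := by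
    have h432 : (432 : k) ≠ 0 := by
      rw [show (432 : k) = 12 * 12 * 3 by norm_num]; exact mul_ne_zero (mul_ne_zero h12 h12) h3
    refine mul_left_cancel₀ h432 ?_
    linear_combination (144 * x₀ ^ 2 + 24 * V.b₂ * x₀ + 72 * V.b₄ - 2 * V.b₂ ^ 2) * hx - 2 * ec₆
  have hE : V.toAffine.Equation x₀ y₀ := by
    rw [Affine.equation_iff]
    refine mul_left_cancel₀ h4 ?_
    linear_combination (2 * y₀ + V.a₁ * x₀ + V.a₃) * hy - hF + x₀ ^ 2 * eb₂ + 2 * x₀ * eb₄ + eb₆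
  exact V.eq_singularModel hE hX hY hs hp

end Field

/-! ## §2 Cusp data of an additively reducing `ℤ_p`-model over the residue field of `K ⊇ ℚ_p`, `p ≥ 5` -/

section Port

variable {p : ℕ} [hp : Fact p.Prime] {K : Type*} [NontriviallyNormedField K] [NormedAlgebra ℚ_[p] K]
  [IsUltrametricDist K] {M : WeierstrassCurve ℤ_[p]}

/-- A natural number `n` with `0 < n < p` is nonzero in the residue field `k` of `K ⊇ ℚ_p` (`char k = p`).
[cite: SerreLocalFields1979, Ch. II §4] -/
theorem natCast_residueField_ne_zero {n : ℕ} (hn0 : 0 < n) (hnp : n < p) :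
    (n : IsLocalRing.ResidueField (unitBall K)) ≠ 0 := by
  haveI := charP_residueField_unitBall p K
  rw [Ne, CharP.cast_eq_zero_iff (IsLocalRing.ResidueField (unitBall K)) p n]
  exact Nat.not_dvd_of_pos_of_lt hn0 hnp

/-- **Cusp data at `p ≥ 5`.** For `M/ℤ_p` with `‖Δ(M)‖ < 1` and `‖c₄(M)‖ < 1` (additive reduction) and any
ultrametric `K ⊇ ℚ_p`, `p ≥ 5`, the reduced cubic `Ṽ = (M ⊗ 𝒪_K) mod 𝔪_K` IS `singularModel x̄₀ ȳ₀ ᾱ ᾱ` for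
`x₀ = −b₂/12`, `y₀ = −(a₁x₀ + a₃)/2`, `α = −a₁/2` computed IN `ℤ_p` (`12` and `2` are units) — the hypothesis
`hV` of the K-port's cusp chart (`…KPortCuspChart`). [cite: SilvermanAEC2009, III.1 Prop. 1.4(a) and III.2 Prop. 2.5(b)] -/
theorem exists_map_residue_eq_singularModel_of_five_le (hp5 : 5 ≤ p) (hΔ : ‖M.Δ‖ < 1) (hc₄ : ‖M.c₄‖ < 1) :
    ∃ x₀ y₀ α : ℤ_[p],
      (M.map (coeffHom p K)).map (IsLocalRing.residue (unitBall K)) =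
        singularModel (IsLocalRing.residue (unitBall K) (coeffHom p K x₀))
          (IsLocalRing.residue (unitBall K) (coeffHom p K y₀))
          (IsLocalRing.residue (unitBall K) (coeffHom p K α))
          (IsLocalRing.residue (unitBall K) (coeffHom p K α)) := by
  set V := (M.map (coeffHom p K)).map (IsLocalRing.residue (unitBall K)) with hVdef
  -- `12` and `2` are units of `ℤ_p` (`p ≥ 5`)
  have hunit : ∀ n : ℕ, 0 < n → n < p → IsUnit ((n : ℕ) : ℤ_[p]) := by
    intro n hn0 hnp
    rw [PadicInt.isUnit_iff]
    have hle := PadicInt.norm_le_one ((n : ℕ) : ℤ_[p])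
    have hnlt : ¬ ‖((n : ℕ) : ℤ_[p])‖ < 1 := by
      rw [PadicInt.norm_natCast_lt_one_iff]
      exact Nat.not_dvd_of_pos_of_lt hn0 hnp
    exact le_antisymm hle (not_lt.mp hnlt)
  have hu2 : IsUnit (2 : ℤ_[p]) := by exact_mod_cast hunit 2 (by norm_num) (by omega)
  have hu3 : IsUnit (3 : ℤ_[p]) := by exact_mod_cast hunit 3 (by norm_num) (by omega)
  have hu12 : IsUnit (12 : ℤ_[p]) := by
    rw [show (12 : ℤ_[p]) = 2 * 2 * 3 by norm_num]
    exact (hu2.mul hu2).mul hu3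
  obtain ⟨u12, hu12'⟩ := hu12.exists_left_inv
  obtain ⟨u2, hu2'⟩ := hu2.exists_left_inv
  -- the cusp data in `ℤ_p`
  set x₀ : ℤ_[p] := -(u12 * M.b₂) with hx₀
  set y₀ : ℤ_[p] := -(u2 * (M.a₁ * x₀ + M.a₃)) with hy₀
  set α : ℤ_[p] := -(u2 * M.a₁) with hα₀
  refine ⟨x₀, y₀, α, ?_⟩
  -- the ring map `ℤ_p → k`
  set φ : ℤ_[p] →+* IsLocalRing.ResidueField (unitBall K) :=
    (IsLocalRing.residue (unitBall K)).comp (coeffHom p K) with hφ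
  have hVφ : V = M.map φ := by rw [hVdef, map_map]
  have h2 : (2 : IsLocalRing.ResidueField (unitBall K)) ≠ 0 := by
    exact_mod_cast natCast_residueField_ne_zero (p := p) (K := K) (n := 2) two_pos (by omega)
  have h3 : (3 : IsLocalRing.ResidueField (unitBall K)) ≠ 0 := by
    exact_mod_cast natCast_residueField_ne_zero (p := p) (K := K) (n := 3) three_pos (by omega)
  have hΔV : V.Δ = 0 := by
    have h := residue_Δ_map_coeffHom_eq_zero (K := K) hΔ
    rw [← map_Δ] at h; exact h
  have hc₄V : V.c₄ = 0 := by
    have h := residue_c₄_map_coeffHom_eq_zero (K := K) hc₄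
    rw [← map_c₄] at h; exact h
  have e12 : φ u12 * 12 = 1 := by
    have h := congrArg φ hu12'
    rw [map_mul, map_one, show (12 : ℤ_[p]) = ((12 : ℕ) : ℤ_[p]) by norm_cast, map_natCast] at h
    exact_mod_cast h
  have e2 : φ u2 * 2 = 1 := by
    have h := congrArg φ hu2'
    rw [map_mul, map_one, show (2 : ℤ_[p]) = ((2 : ℕ) : ℤ_[p]) by norm_cast, map_natCast] at h
    exact_mod_cast h
  have hx : 12 * φ x₀ = -V.b₂ := by
    rw [hVφ, map_b₂, hx₀, map_neg, map_mul]
    linear_combination (-(φ M.b₂)) * e12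
  have hy : 2 * φ y₀ = -(V.a₁ * φ x₀ + V.a₃) := by
    rw [hVφ, map_a₁, map_a₃, hy₀, map_neg, map_mul, map_add, map_mul]
    linear_combination (-(φ M.a₁ * φ x₀ + φ M.a₃)) * e2
  have hα : 2 * φ α = -V.a₁ := by
    rw [hVφ, map_a₁, hα₀, map_neg, map_mul]
    linear_combination (-(φ M.a₁)) * e2
  exact eq_singularModel_of_cusp V h2 h3 hΔV hc₄V hx hy hα

variable (W : WeierstrassCurve ℚ) [W.IsElliptic] [W.IsGloballyMinimal]

/-- **Cusp data of `W_ℤ ⊗ ℤ_p` at an additive prime `p ≥ 5` of a globally minimal `W/ℚ`**, over the residue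
field of any ultrametric `K ⊇ ℚ_p`: the hypothesis `hV` of the K-port's cusp chart `r : E₀(K) ↠ k⁺`.
[cite: SilvermanAEC2009, III.2 Prop. 2.5(b) and VII.5 Prop. 5.1] -/
theorem exists_cuspData_of_addv (hp5 : 5 ≤ p) (hadd : Addv W p) :
    ∃ x₀ y₀ α : ℤ_[p],
      (((integralModelInt W).map (Int.castRingHom ℤ_[p])).map (coeffHom p K)).map
          (IsLocalRing.residue (unitBall K)) =
        singularModel (IsLocalRing.residue (unitBall K) (coeffHom p K x₀))
          (IsLocalRing.residue (unitBall K) (coeffHom p K y₀))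
          (IsLocalRing.residue (unitBall K) (coeffHom p K α))
          (IsLocalRing.residue (unitBall K) (coeffHom p K α)) :=
  exists_map_residue_eq_singularModel_of_five_le hp5 (norm_Δ_lt_one_of_addv W hadd).1
    (norm_Δ_lt_one_of_addv W hadd).2

end Port

end Summit.BirchSwinnertonDyer.BirchSwinnertonDyer.Theorems.StarredOptimalManinUnitFiveSevenReceptacle

end
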